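import Mathlib.Analysis.Fourier.LpSpace
import Mathlib.Analysis.Distribution.AEEqOfIntegralContDiff
import Mathlib.MeasureTheory.Function.LocallyIntegrable
import HarnessLib

/-!
# Plancherel for `L¹ ∩ L²` functions via the `L²` Fourier transform

Eighth file of the Fourier-side construction of Leray's local regular solution
(`Literature.Fluid.local_regular_solution`; plan in `NSLocalRegular`). Mathlib (this pin) has the
Fourier transform on `L²` as a linear isometry (`MeasureTheory.Lp.fourierTransformₗᵢ`, obtained
by density from the Schwartz space) and its agreement with the transform on tempered
distributions (`MeasureTheory.Lp.fourier_toTemperedDistribution_eq`), but no statement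
identifying it with the Fourier *integral* of an `L¹ ∩ L²` function. This file supplies that
identification and the resulting Plancherel identity for functions:

* `fourier_ae_eq_fourierIntegral`: for `w ∈ L¹ ∩ L²`, the `L²` transform of `w` is a.e. equal
  to the Fourier integral `𝓕 w` (both induce the tempered distribution `𝓕 T_w`; test against
  Schwartz functions via the self-adjointness `∫ 𝓕 g · w = ∫ g · 𝓕 w`, then
  `ae_eq_of_integral_contDiff_smul_eq`);
* `memLp_two_fourierIntegral`, `eLpNorm_fourierIntegral_eq`: `𝓕 w ∈ L²` and
  `‖𝓕 w‖_{L²} = ‖w‖_{L²}` (Plancherel 1910; Stein–Weiss 1971, Ch. I, Thm. 2.3).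

## Mathlib search

`MeasureTheory.Lp.fourierTransformₗᵢ`, `MeasureTheory.Lp.norm_fourier_eq`,
`MeasureTheory.Lp.fourier_toTemperedDistribution_eq`, `MeasureTheory.Lp.toTemperedDistribution_apply`,
`TemperedDistribution.fourier_apply`, `VectorFourier.integral_fourierIntegral_smul_eq_flip`,
`ae_eq_of_integral_contDiff_smul_eq`, `HasCompactSupport.toSchwartzMap`.

## References

* E. M. Stein, G. Weiss, *Introduction to Fourier Analysis on Euclidean Spaces*, PUP 1971,
  Ch. I, Thm. 2.3 (Plancherel).
-/

noncomputable section

open MeasureTheory Real Set Filter Topology Function Complex FourierTransform SchwartzMap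
open scoped FourierTransform RealInnerProductSpace ENNReal ContDiff

namespace Literature.Analysis.FluidPDE.FourierNS

variable {V : Type*} [NormedAddCommGroup V] [InnerProductSpace ℝ V] [FiniteDimensional ℝ V]
  [MeasurableSpace V] [BorelSpace V]

/-- An integrable function with a uniform bound is in `L²` (`‖f‖² ≤ C ‖f‖`). [folklore] -/
theorem memLp_two_of_bound {f : V → ℂ} (hf : Integrable f) {C : ℝ} (hC : ∀ x, ‖f x‖ ≤ C) :
    MemLp f 2 volume := by
  have hC0 : 0 ≤ C := (norm_nonneg _).trans (hC 0)
  refine ⟨hf.aestronglyMeasurable, ?_⟩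
  have h2 : eLpNorm f 2 volume = (∫⁻ x, ‖f x‖ₑ ^ (2 : ℝ)) ^ (1 / (2 : ℝ)) :=
    eLpNorm_eq_lintegral_rpow_enorm_toReal (by norm_num) (by norm_num)
  rw [h2]
  refine ENNReal.rpow_lt_top_of_nonneg (by norm_num) (ne_of_lt ?_)
  calc ∫⁻ x, ‖f x‖ₑ ^ (2 : ℝ) ≤ ∫⁻ x, ENNReal.ofReal C * ‖f x‖ₑ := by
        refine lintegral_mono fun x => ?_
        rw [show (2 : ℝ) = (2 : ℕ) by norm_num, ENNReal.rpow_natCast, sq]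
        gcongr
        rw [← ofReal_norm]
        exact ENNReal.ofReal_le_ofReal (hC x)
    _ = ENNReal.ofReal C * ∫⁻ x, ‖f x‖ₑ := lintegral_const_mul' _ _ ENNReal.ofReal_ne_top
    _ < ⊤ := ENNReal.mul_lt_top ENNReal.ofReal_lt_top hf.2

/-- The Fourier integral of an integrable function is continuous (Mathlib
`VectorFourier.fourierIntegral_continuous`). [folklore] -/
theorem continuous_fourierIntegral {w : V → ℂ} (hw : Integrable w) : Continuous (𝓕 w) :=
  VectorFourier.fourierIntegral_continuous Real.continuous_fourierChar continuous_inner hw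

/-- Self-adjointness against a Schwartz test function: `∫ (𝓕 g) · w = ∫ g · (𝓕 w)` for
integrable `w` (Mathlib `VectorFourier.integral_fourierIntegral_smul_eq_flip`). [folklore] -/
theorem integral_fourier_schwartz_smul_eq {w : V → ℂ} (hw : Integrable w) (g : 𝓢(V, ℂ)) :
    ∫ x, (𝓕 (g : V → ℂ)) x • w x = ∫ ξ, g ξ • (𝓕 w) ξ := by
  have h := VectorFourier.integral_fourierIntegral_smul_eq_flip (e := 𝐞) (μ := volume)
    (ν := volume) (L := innerₗ V) (f := (g : V → ℂ)) (g := w) Real.continuous_fourierChar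
    continuous_inner g.integrable hw
  have hflip : (innerₗ V).flip = innerₗ V := by
    ext v w'
    rw [LinearMap.flip_apply, innerₗ_apply_apply, innerₗ_apply_apply, real_inner_comm]
  rw [hflip] at h
  exact h

/-- **The `L²` Fourier transform of an `L¹ ∩ L²` function is its Fourier integral** (a.e.):
both induce the tempered distribution `𝓕 T_w`. [folklore] -/
theorem fourier_toLp_ae_eq {w : V → ℂ} (hw : Integrable w) (hw2 : MemLp w 2 volume) :
    ((𝓕 (hw2.toLp w) : Lp ℂ 2 (volume : Measure V)) : V → ℂ) =ᵐ[volume] 𝓕 w := by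
  set W₂ : Lp ℂ 2 (volume : Measure V) := hw2.toLp w with hW₂
  set U : Lp ℂ 2 (volume : Measure V) := 𝓕 W₂ with hU
  have hW₂w : (W₂ : V → ℂ) =ᵐ[volume] w := hw2.coeFn_toLp
  -- testing against Schwartz functions
  have key : ∀ g : 𝓢(V, ℂ), ∫ x, g x • (U : V → ℂ) x = ∫ x, g x • 𝓕 w x := by
    intro g
    have h1 : ∫ x, g x • (U : V → ℂ) x = (Lp.toTemperedDistribution U) g :=
      (Lp.toTemperedDistribution_apply U g).symm
    have h2 : Lp.toTemperedDistribution U = 𝓕 (Lp.toTemperedDistribution W₂) :=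
      (Lp.fourier_toTemperedDistribution_eq W₂).symm
    rw [h1, h2, TemperedDistribution.fourier_apply, Lp.toTemperedDistribution_apply,
      ← integral_fourier_schwartz_smul_eq hw g, SchwartzMap.fourier_coe]
    refine integral_congr_ae ?_
    filter_upwards [hW₂w] with x hx
    rw [hx]
  -- conclude by density of real test functions
  refine ae_eq_of_integral_contDiff_smul_eq ((Lp.memLp U).locallyIntegrable (by norm_num))
    (continuous_fourierIntegral hw).locallyIntegrable fun φ hφ hsupp => ?_
  have hφc : HasCompactSupport fun x => ((φ x : ℝ) : ℂ) := hsupp.comp_left Complex.ofReal_zero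
  have hφs : ContDiff ℝ ∞ fun x => ((φ x : ℝ) : ℂ) := ofRealCLM.contDiff.comp hφ
  have h := key (hφc.toSchwartzMap hφs)
  have hcoe : ∀ x, (hφc.toSchwartzMap hφs) x = ((φ x : ℝ) : ℂ) := fun x => rfl
  simp only [hcoe] at h
  simpa only [Complex.real_smul, smul_eq_mul] using h

/-- **`𝓕 w ∈ L²`** for `w ∈ L¹ ∩ L²`. [folklore] -/
theorem memLp_two_fourierIntegral {w : V → ℂ} (hw : Integrable w) (hw2 : MemLp w 2 volume) :
    MemLp (𝓕 w) 2 volume :=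
  (Lp.memLp _).ae_eq (fourier_toLp_ae_eq hw hw2)

/-- **Plancherel for `L¹ ∩ L²` functions**: `‖𝓕 w‖_{L²} = ‖w‖_{L²}` (Mathlib's `L²` isometry
`MeasureTheory.Lp.norm_fourier_eq` transported along `fourier_toLp_ae_eq`; Stein–Weiss 1971,
Ch. I, Thm. 2.3). [folklore] -/
theorem eLpNorm_fourierIntegral_eq {w : V → ℂ} (hw : Integrable w) (hw2 : MemLp w 2 volume) :
    eLpNorm (𝓕 w) 2 volume = eLpNorm w 2 volume := by
  have hae := fourier_toLp_ae_eq hw hw2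
  rw [← eLpNorm_congr_ae hae]
  have h1 : eLpNorm ((𝓕 (hw2.toLp w) : Lp ℂ 2 (volume : Measure V)) : V → ℂ) 2 volume =
      ENNReal.ofReal ‖(𝓕 (hw2.toLp w) : Lp ℂ 2 (volume : Measure V))‖ := by
    rw [Lp.norm_def, ENNReal.ofReal_toReal (Lp.eLpNorm_ne_top _)]
  rw [h1, Lp.norm_fourier_eq, Lp.norm_toLp, ENNReal.ofReal_toReal hw2.eLpNorm_ne_top]

/-- Plancherel for differences: `‖𝓕 w₁ - 𝓕 w₂‖_{L²} = ‖w₁ - w₂‖_{L²}`. [folklore] -/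
theorem eLpNorm_fourierIntegral_sub_eq {w₁ w₂ : V → ℂ} (h₁ : Integrable w₁) (h₁' : MemLp w₁ 2 volume)
    (h₂ : Integrable w₂) (h₂' : MemLp w₂ 2 volume) :
    eLpNorm (𝓕 w₁ - 𝓕 w₂) 2 volume = eLpNorm (w₁ - w₂) 2 volume := by
  have hsub : 𝓕 w₁ - 𝓕 w₂ = 𝓕 (w₁ - w₂) := by
    funext x
    simp only [Pi.sub_apply, Real.fourier_eq]
    rw [← integral_sub ((Real.fourierIntegral_convergent_iff x).2 h₁)
      ((Real.fourierIntegral_convergent_iff x).2 h₂)]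
    congr 1 with v
    rw [smul_sub]
  rw [hsub]
  exact eLpNorm_fourierIntegral_eq (h₁.sub h₂) (h₁'.sub h₂')

end Literature.Analysis.FluidPDE.FourierNS

end
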